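import Mathlib.Topology.Order.Compact
import Mathlib.Analysis.Calculus.IteratedDeriv.Lemmas
import Literature.Analysis.FunctionSpaces.TorusDerivSizeBounds
import HarnessLib

/-!
# Uniform third-order derivative bounds for the coefficients of the symmetrised Euler system

Analysis/FluidPDE support file (everything proved; no named facts), part of the programme
proving `Literature.Analysis.FluidPDE.CompressibleEulerLocalWellPosedness` (Majda 1984,
Thms 2.1–2.2). In primitive variables `(ρ, u, ϑ)` the Euler system of the athermal monatomic
law `p = ρϑζ(ρ)`, `e = 3ϑ/2` is symmetrised by the weights `a = ϑ h'(ρ)/ρ`, `c = ρ`,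
`d₃ = 3ρ/(2ϑ)` (`h(s) = sζ(s)`), with the further coefficients `b = ζ(ρ)`, `g = (2/3)ϑζ(ρ)`.
The `H³` estimate behind the continuation principle (Majda 1984, Thm 2.2) needs, at every point,
bounds for these coefficients and their derivatives of orders `≤ 3` in terms of the second and
third derivative sizes of `(ρ, ϑ)`, with constants depending ONLY on a priori bounds
`m ≤ ρ ≤ ρ̄₁ < ρ̄`, `m ≤ ϑ ≤ Θ`, `|∂ᵢρ|, |∂ᵢϑ| ≤ M₁` and on `ζ` — the elementary case of Majda's
Prop. 2.1. `exists_coefficient_bounds` provides such constants `C ≥ 1` and `δ > 0` (lower bound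
for the weights `a, c, d₃`), uniformly in the functions (expressed by the order of quantifiers),
from the size calculus of `TorusDerivSizeBounds` and compactness of `[m, ρ̄₁]`, `[m, Θ]`.

## References

* A. Majda, *Compressible Fluid Flow and Systems of Conservation Laws in Several Space
  Variables*, Springer 1984, Ch. 2 §2.1, Prop. 2.1, Thm 2.2; Ch. 1 (symmetriser of the Euler
  equations). [`Majda1984`]
-/

noncomputable section

open Set Function
open scoped ContDiff

namespace Literature.Analysis.FluidPDE

namespace CompressibleEuler

open Literature.Analysis.FunctionSpaces FunctionSpaces.Torus

variable {d : Type*} [Fintype d] [DecidableEq d]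

/-! ## Uniform bounds for a smooth function and three derivatives on a compact interval -/

omit [Fintype d] [DecidableEq d] in
/-- A function smooth on an open set `V` is bounded, together with its first three derivatives,
on every compact interval `[lo, hi] ⊆ V`, by a common constant `K ≥ 0`. [folklore] -/
theorem exists_bound_derivs₃ {φ : ℝ → ℝ} {V : Set ℝ} (hφ : ContDiffOn ℝ ∞ φ V) (hV : IsOpen V)
    {lo hi : ℝ} (hI : Icc lo hi ⊆ V) :
    ∃ K : ℝ, 0 ≤ K ∧ ∀ s ∈ Icc lo hi, |φ s| ≤ K ∧ |deriv φ s| ≤ K ∧ |deriv (deriv φ) s| ≤ K ∧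
      |deriv (deriv (deriv φ)) s| ≤ K := by
  have h1 : ContDiffOn ℝ ∞ (deriv φ) V := hφ.deriv_of_isOpen hV (by simp)
  have h2 : ContDiffOn ℝ ∞ (deriv (deriv φ)) V := h1.deriv_of_isOpen hV (by simp)
  have h3 : ContDiffOn ℝ ∞ (deriv (deriv (deriv φ))) V := h2.deriv_of_isOpen hV (by simp)
  obtain ⟨K₀, hK₀⟩ := isCompact_Icc.exists_bound_of_continuousOn (hφ.continuousOn.mono hI)
  obtain ⟨K₁, hK₁⟩ := isCompact_Icc.exists_bound_of_continuousOn (h1.continuousOn.mono hI)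
  obtain ⟨K₂, hK₂⟩ := isCompact_Icc.exists_bound_of_continuousOn (h2.continuousOn.mono hI)
  obtain ⟨K₃, hK₃⟩ := isCompact_Icc.exists_bound_of_continuousOn (h3.continuousOn.mono hI)
  refine ⟨max (max (max (max K₀ K₁) K₂) K₃) 0, le_max_right _ _, fun s hs => ⟨?_, ?_, ?_, ?_⟩⟩
  · have := hK₀ s hs; rw [Real.norm_eq_abs] at this
    exact this.trans (by simp)
  · have := hK₁ s hs; rw [Real.norm_eq_abs] at this
    exact this.trans (by simp)
  · have := hK₂ s hs; rw [Real.norm_eq_abs] at this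
    exact this.trans (by simp)
  · have := hK₃ s hs; rw [Real.norm_eq_abs] at this
    exact this.trans (by simp)

variable {ζ : ℝ → ℝ} {ρm : ℝ}

/-- `k(s) = h'(s)/s`, `h(s) = sζ(s)`, is smooth on `(0, ∞)` when `ζ` is smooth. [folklore] -/
theorem contDiffOn_kfun (hζ : ContDiff ℝ ∞ ζ) :
    ContDiffOn ℝ ∞ (fun s : ℝ => deriv (fun r : ℝ => r * ζ r) s / s) (Ioi 0) := by
  have hdh : ContDiff ℝ ∞ (deriv fun r : ℝ => r * ζ r) :=
    (contDiff_infty_iff_deriv.1 (contDiff_id.mul hζ)).2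
  exact hdh.contDiffOn.div contDiffOn_id fun _ hs => ne_of_gt hs

omit [Fintype d] [DecidableEq d] in
/-- `s ↦ s⁻¹` is smooth on `(0, ∞)`. [folklore] -/
theorem contDiffOn_inv_Ioi : ContDiffOn ℝ ∞ (fun s : ℝ => s⁻¹) (Ioi 0) :=
  (contDiffOn_inv ℝ).mono fun _ hs => ne_of_gt hs

/-- **Uniform coefficient bounds for the symmetrised Euler system** (the elementary case of
Majda 1984, Prop. 2.1, for the coefficients `a = ϑh'(ρ)/ρ`, `b = ζ(ρ)`, `c = ρ`,
`g = (2/3)ϑζ(ρ)`, `d₃ = 3ρ/(2ϑ)` and the unknown `ϑ`): for `ζ` smooth with `(sζ)' > 0` on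
`(0, ρ̄)` and levels `0 < m`, `ρ̄₁ < ρ̄`, `0 ≤ M₁`, there are `C ≥ 1` and `δ > 0` such that for ALL
smooth `ρ, ϑ` on `𝕋^d` with `m ≤ ρ ≤ ρ̄₁`, `m ≤ ϑ ≤ Θ` and `|∂ᵢρ|, |∂ᵢϑ| ≤ M₁`, at every point each
of these functions satisfies `HasDerivBoundsAt₃ · x C S₂ S₃` with the common sizes
`S₂ = dsize₂ ρ x + dsize₂ ϑ x`, `S₃ = dsize₃ ρ x + dsize₃ ϑ x`, and the weights are bounded below:
`a, c, d₃ ≥ δ`. [cite: Majda1984, Ch. 2 §2.1 Prop. 2.1] -/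
theorem exists_coefficient_bounds (hζ : ContDiff ℝ ∞ ζ)
    (hζ' : ∀ r ∈ Ioo 0 ρm, 0 < deriv (fun s : ℝ => s * ζ s) r)
    {m ρhi Θ M₁ : ℝ} (hm : 0 < m) (hρhi : ρhi < ρm) (hM0 : 0 ≤ M₁) :
    ∃ C δ : ℝ, 1 ≤ C ∧ 0 < δ ∧ ∀ (ρ ϑ : UnitAddTorus d → ℝ), IsSmooth ρ → IsSmooth ϑ →
      (∀ y, m ≤ ρ y ∧ ρ y ≤ ρhi ∧ m ≤ ϑ y ∧ ϑ y ≤ Θ) →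
      (∀ y i, |partialDeriv i ρ y| ≤ M₁ ∧ |partialDeriv i ϑ y| ≤ M₁) → ∀ x,
      HasDerivBoundsAt₃ (fun y => ϑ y * (deriv (fun s : ℝ => s * ζ s) (ρ y) / ρ y)) x C
          (dsize₂ ρ x + dsize₂ ϑ x) (dsize₃ ρ x + dsize₃ ϑ x) ∧
        HasDerivBoundsAt₃ (fun y => ζ (ρ y)) x C (dsize₂ ρ x + dsize₂ ϑ x) (dsize₃ ρ x + dsize₃ ϑ x) ∧
        HasDerivBoundsAt₃ ρ x C (dsize₂ ρ x + dsize₂ ϑ x) (dsize₃ ρ x + dsize₃ ϑ x) ∧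
        HasDerivBoundsAt₃ (fun y => 2 / 3 * (ϑ y * ζ (ρ y))) x C
          (dsize₂ ρ x + dsize₂ ϑ x) (dsize₃ ρ x + dsize₃ ϑ x) ∧
        HasDerivBoundsAt₃ (fun y => 3 / 2 * (ρ y * (ϑ y)⁻¹)) x C
          (dsize₂ ρ x + dsize₂ ϑ x) (dsize₃ ρ x + dsize₃ ϑ x) ∧
        HasDerivBoundsAt₃ ϑ x C (dsize₂ ρ x + dsize₂ ϑ x) (dsize₃ ρ x + dsize₃ ϑ x) ∧
        δ ≤ ϑ x * (deriv (fun s : ℝ => s * ζ s) (ρ x) / ρ x) ∧ δ ≤ ρ x ∧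
        δ ≤ 3 / 2 * (ρ x * (ϑ x)⁻¹) := by
  set kf : ℝ → ℝ := fun s => deriv (fun r : ℝ => r * ζ r) s / s with hkf
  have hk : ContDiffOn ℝ ∞ kf (Ioi 0) := contDiffOn_kfun hζ
  have hIρ : Icc m ρhi ⊆ Ioi (0 : ℝ) := fun s hs => hm.trans_le hs.1
  have hIϑ : Icc m Θ ⊆ Ioi (0 : ℝ) := fun s hs => hm.trans_le hs.1
  -- uniform constants on the compact ranges
  obtain ⟨Kk, hKk0, hKk⟩ := exists_bound_derivs₃ hk isOpen_Ioi hIρ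
  obtain ⟨Kζ, hKζ0, hKζ⟩ := exists_bound_derivs₃ (hζ.contDiffOn (s := univ)) isOpen_univ (subset_univ (Icc m ρhi))
  obtain ⟨Ki, hKi0, hKi⟩ := exists_bound_derivs₃ contDiffOn_inv_Ioi isOpen_Ioi hIϑ
  -- lower bound for `k` on `[m, ρhi]`
  have hkpos : ∀ s ∈ Icc m ρhi, 0 < kf s := fun s hs =>
    div_pos (hζ' s ⟨hm.trans_le hs.1, hs.2.trans_lt hρhi⟩) (hm.trans_le hs.1)
  obtain ⟨kmin, hkmin0, hkmin⟩ : ∃ kmin : ℝ, 0 < kmin ∧ ∀ s ∈ Icc m ρhi, kmin ≤ kf s := by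
    by_cases hmr : m ≤ ρhi
    · obtain ⟨s₀, hs₀, hmin⟩ := isCompact_Icc.exists_isMinOn (nonempty_Icc.2 hmr)
        (hk.continuousOn.mono hIρ)
      exact ⟨kf s₀, hkpos s₀ hs₀, fun s hs => hmin hs⟩
    · exact ⟨1, one_pos, fun s hs => absurd (hs.1.trans hs.2) hmr⟩
  set Θ' : ℝ := max Θ m with hΘ'
  have hΘ'0 : 0 < Θ' := hm.trans_le (le_max_right _ _)
  -- the constants
  set Cρ : ℝ := max (max (max |ρhi| |m|) M₁) 1 with hCρ
  set Cϑ : ℝ := max (max Θ' M₁) 1 with hCϑ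
  set Ck : ℝ := Kk * (1 + M₁) ^ 3 with hCk
  set Cz : ℝ := Kζ * (1 + M₁) ^ 3 with hCz
  set Ci : ℝ := Ki * (1 + M₁) ^ 3 with hCi
  set C : ℝ := max (max (max (max (max Cρ Cϑ) (8 * Cϑ * Ck)) Cz) (|(2 : ℝ) / 3| * (8 * Cϑ * Cz)))
    (|(3 : ℝ) / 2| * (8 * Cρ * Ci)) with hC
  set δ : ℝ := min (min (m * kmin) m) (3 / 2 * (m * Θ'⁻¹)) with hδ
  have hC1 : 1 ≤ C := by
    have : (1 : ℝ) ≤ Cρ := le_max_right _ _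
    simp only [hC, le_max_iff]; left; left; left; left; left; exact this
  have hδ0 : 0 < δ := by
    simp only [hδ, lt_min_iff]
    exact ⟨⟨mul_pos hm hkmin0, hm⟩, by positivity⟩
  refine ⟨C, δ, hC1, hδ0, fun ρ ϑ hρ hϑ hb hd x => ?_⟩
  have hρx : ∀ y, ρ y ∈ Icc m ρhi := fun y => ⟨(hb y).1, (hb y).2.1⟩
  have hϑx : ∀ y, ϑ y ∈ Icc m Θ := fun y => ⟨(hb y).2.2.1, (hb y).2.2.2⟩
  have hρpos : ∀ y, 0 < ρ y := fun y => hm.trans_le (hb y).1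
  have hϑpos : ∀ y, 0 < ϑ y := fun y => hm.trans_le (hb y).2.2.1
  have hS₂ : 0 ≤ dsize₂ ρ x + dsize₂ ϑ x := add_nonneg (dsize₂_nonneg _ _) (dsize₂_nonneg _ _)
  have hS₃ : 0 ≤ dsize₃ ρ x + dsize₃ ϑ x := add_nonneg (dsize₃_nonneg _ _) (dsize₃_nonneg _ _)
  -- the unknowns
  have Hρ : HasDerivBoundsAt₃ ρ x Cρ (dsize₂ ρ x + dsize₂ ϑ x) (dsize₃ ρ x + dsize₃ ϑ x) := by
    have h := hasDerivBoundsAt₃_self (w := ρ) (x := x) (A := max |ρhi| |m|) (M₁ := M₁)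
      (by rw [abs_of_pos (hρpos x)]; exact ((hb x).2.1.trans (le_abs_self _)).trans (le_max_left _ _))
      (fun i => (hd x i).1)
    exact h.mono_size (le_add_of_nonneg_right (dsize₂_nonneg _ _)) (le_add_of_nonneg_right (dsize₃_nonneg _ _))
  have Hϑ : HasDerivBoundsAt₃ ϑ x Cϑ (dsize₂ ρ x + dsize₂ ϑ x) (dsize₃ ρ x + dsize₃ ϑ x) := by
    have h := hasDerivBoundsAt₃_self (w := ϑ) (x := x) (A := Θ') (M₁ := M₁)
      (by rw [abs_of_pos (hϑpos x)]; exact (hb x).2.2.2.trans (le_max_left _ _))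
      (fun i => (hd x i).2)
    exact h.mono_size (le_add_of_nonneg_left (dsize₂_nonneg _ _)) (le_add_of_nonneg_left (dsize₃_nonneg _ _))
  -- the composites
  have Hk : HasDerivBoundsAt₃ (fun y => kf (ρ y)) x Ck (dsize₂ ρ x + dsize₂ ϑ x) (dsize₃ ρ x + dsize₃ ϑ x) := by
    have h := hasDerivBoundsAt₃_comp hk isOpen_Ioi hρ (fun y => hρpos y)
      (fun y => (hKk _ (hρx y)).1) (fun y => (hKk _ (hρx y)).2.1) (fun y => (hKk _ (hρx y)).2.2.1)
      (fun y => (hKk _ (hρx y)).2.2.2) hM0 (fun y i => (hd y i).1) x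
    exact h.mono_size (le_add_of_nonneg_right (dsize₂_nonneg _ _)) (le_add_of_nonneg_right (dsize₃_nonneg _ _))
  have Hz : HasDerivBoundsAt₃ (fun y => ζ (ρ y)) x Cz (dsize₂ ρ x + dsize₂ ϑ x) (dsize₃ ρ x + dsize₃ ϑ x) := by
    have h := hasDerivBoundsAt₃_comp (hζ.contDiffOn (s := univ)) isOpen_univ hρ (fun y => mem_univ _)
      (fun y => (hKζ _ (hρx y)).1) (fun y => (hKζ _ (hρx y)).2.1) (fun y => (hKζ _ (hρx y)).2.2.1)
      (fun y => (hKζ _ (hρx y)).2.2.2) hM0 (fun y i => (hd y i).1) x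
    exact h.mono_size (le_add_of_nonneg_right (dsize₂_nonneg _ _)) (le_add_of_nonneg_right (dsize₃_nonneg _ _))
  have Hi : HasDerivBoundsAt₃ (fun y => (ϑ y)⁻¹) x Ci (dsize₂ ρ x + dsize₂ ϑ x) (dsize₃ ρ x + dsize₃ ϑ x) := by
    have h := hasDerivBoundsAt₃_comp (φ := fun s : ℝ => s⁻¹) contDiffOn_inv_Ioi isOpen_Ioi hϑ
      (fun y => hϑpos y)
      (fun y => (hKi _ (hϑx y)).1) (fun y => (hKi _ (hϑx y)).2.1) (fun y => (hKi _ (hϑx y)).2.2.1)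
      (fun y => (hKi _ (hϑx y)).2.2.2) hM0 (fun y i => (hd y i).2) x
    exact h.mono_size (le_add_of_nonneg_left (dsize₂_nonneg _ _)) (le_add_of_nonneg_left (dsize₃_nonneg _ _))
  -- products
  have hkfs : IsSmooth (fun y => kf (ρ y)) := IsSmooth.comp_of_contDiffOn hk hρ fun y => hρpos y
  have hzs : IsSmooth (fun y => ζ (ρ y)) :=
    IsSmooth.comp_of_contDiffOn (hζ.contDiffOn (s := univ)) hρ fun y => mem_univ _
  have his : IsSmooth (fun y => (ϑ y)⁻¹) :=
    IsSmooth.comp_of_contDiffOn (φ := fun s : ℝ => s⁻¹) contDiffOn_inv_Ioi hϑ fun y => hϑpos y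
  have Ha : HasDerivBoundsAt₃ (fun y => ϑ y * kf (ρ y)) x (8 * Cϑ * Ck)
      (dsize₂ ρ x + dsize₂ ϑ x) (dsize₃ ρ x + dsize₃ ϑ x) := Hϑ.mul Hk hϑ hkfs hS₂ hS₃
  have Hg : HasDerivBoundsAt₃ (fun y => 2 / 3 * (ϑ y * ζ (ρ y))) x (|(2 : ℝ) / 3| * (8 * Cϑ * Cz))
      (dsize₂ ρ x + dsize₂ ϑ x) (dsize₃ ρ x + dsize₃ ϑ x) :=
    (Hϑ.mul Hz hϑ hzs hS₂ hS₃).const_mul (ContDiff.mul hϑ hzs : IsSmooth fun y => ϑ y * ζ (ρ y)) _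
  have Hd : HasDerivBoundsAt₃ (fun y => 3 / 2 * (ρ y * (ϑ y)⁻¹)) x (|(3 : ℝ) / 2| * (8 * Cρ * Ci))
      (dsize₂ ρ x + dsize₂ ϑ x) (dsize₃ ρ x + dsize₃ ϑ x) :=
    (Hρ.mul Hi hρ his hS₂ hS₃).const_mul (ContDiff.mul hρ his : IsSmooth fun y => ρ y * (ϑ y)⁻¹) _
  -- collect
  have le1 : Cρ ≤ C := by simp only [hC, le_max_iff]; left; left; left; left; left; exact le_rfl
  have le2 : Cϑ ≤ C := by simp only [hC, le_max_iff]; left; left; left; left; right; exact le_rfl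
  have le3 : 8 * Cϑ * Ck ≤ C := by simp only [hC, le_max_iff]; left; left; left; right; exact le_rfl
  have le4 : Cz ≤ C := by simp only [hC, le_max_iff]; left; left; right; exact le_rfl
  have le5 : |(2 : ℝ) / 3| * (8 * Cϑ * Cz) ≤ C := by simp only [hC, le_max_iff]; left; right; exact le_rfl
  have le6 : |(3 : ℝ) / 2| * (8 * Cρ * Ci) ≤ C := by simp only [hC, le_max_iff]; right; exact le_rfl
  refine ⟨?_, Hz.mono le4 hS₂ hS₃, Hρ.mono le1 hS₂ hS₃, Hg.mono le5 hS₂ hS₃, Hd.mono le6 hS₂ hS₃,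
    Hϑ.mono le2 hS₂ hS₃, ?_, ?_, ?_⟩
  · exact Ha.mono le3 hS₂ hS₃
  · -- `δ ≤ m kmin ≤ ϑ k(ρ)`
    have h1 : δ ≤ m * kmin := (min_le_left _ _).trans (min_le_left _ _)
    have h2 : m * kmin ≤ ϑ x * kf (ρ x) :=
      mul_le_mul (hb x).2.2.1 (hkmin _ (hρx x)) hkmin0.le (hϑpos x).le
    exact h1.trans h2
  · exact ((min_le_left _ _).trans (min_le_right _ _)).trans (hb x).1
  · have h1 : δ ≤ 3 / 2 * (m * Θ'⁻¹) := min_le_right _ _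
    have h2 : m * Θ'⁻¹ ≤ ρ x * (ϑ x)⁻¹ := by
      have hϑle : ϑ x ≤ Θ' := (hb x).2.2.2.trans (le_max_left _ _)
      exact mul_le_mul (hb x).1 ((inv_le_inv₀ hΘ'0 (hϑpos x)).2 hϑle) (inv_nonneg.2 hΘ'0.le) (hρpos x).le
    nlinarith

end CompressibleEuler

end Literature.Analysis.FluidPDE

end
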